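import Mathlib
import Summits.ValiantsHypothesis.ValiantsHypothesis.Theses.LiouvilleSarnak
import Summits.ValiantsHypothesis.ValiantsHypothesis.Theorems.LiouvilleSarnakAlignedCutRank
import Summits.ValiantsHypothesis.ValiantsHypothesis.Theorems.LiouvilleSarnakAlignedTypeIOfDigitalBilinear
import Summits.ValiantsHypothesis.ValiantsHypothesis.Theorems.LiouvilleSarnakLiouvilleCutRankOneBlock

/-!
# Route LiouvilleSarnak — crux `LiouvilleCutRank` (stmt-ValiantsHypothesis-14775):
# a NEW UNCONDITIONAL CLASS — cuts aligned up to `k` stray row bits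

The aligned rung (`AlignedCutRank`, Coons) and the aligned-window theorems handle cuts whose `n` row bits
are the `n` low (or high) positions.  This file proves the rank bound for every cut at level `n₁` whose
TOP `n₁ - k` positions are row bits — the remaining `k` row bits may sit ANYWHERE among the `n₁ + k`
lower positions, interleaved with the column bits in any way:

* ★ `le_rank_of_topRows`: for all `W, k` there is `n₀` such that for every `n₁ ≥ n₀` and every balanced
  cut `π₁` of `2n₁` positions with `(π₁.symm j).isLeft` for all `j ≥ n₁ + k`, `W ≤ rank M_{π₁}`.

Proof (pigeonhole over the stray rows, on top of `AlignedCutRank`).  Put `m = n₁ + k`, `T = n₁ - k`.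
Freeze the `k` stray row bits to a pattern `u`; the rows of the resulting submatrix are the top digit
strings `t ∈ {0,1}^T`, and its column at column digits `c` is the vector
`t ↦ λ(2^m · ofBits t + G(u, c) + 1)`, where `G(u, c) < 2^m` collects the low digits (§1, an explicit
`Equiv` rows `≃` strays `×` top digits).  Every `ρ < 2^m` is `G(u, c)` for some `(u, c)` (§1), in
particular `ρ = 4^k (a + 1) - 1`, for which the column is `t ↦ λ(4^k (a + 2^T ofBits t + 1))
= λ(a + 2^T b + 1)` — the ROW `a` of the aligned level-`T` matrix (`λ(4^k x) = λ(x)`).  By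
`AlignedCutRank` (rank `→ ∞`) the aligned matrix has `≥ 2^{k+W}` distinct rows for `T` large, so the
columns `{col(u, c)}` over ALL `(u, c)` number `≥ 2^{k+W}` distinct vectors; the `2^k` patterns `u`
partition them, so some `u*` sees `≥ 2^W` distinct columns, whence (a `±1` matrix with `R` distinct
columns has `R ≤ 2^{rank}`) the `u*`-submatrix, and `M_{π₁}`, have rank `≥ W`.

Honest framing: an unconditional extension of the solved class of the OPEN crux `LiouvilleCutRank`
(from "aligned" to "aligned up to `k` strays", each fixed `k`); the crux for general cuts,
`DigitalBilinearLiouville` and `AlgebraicSarnak` stay OPEN, and nothing here bears on VP versus VNP.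
No definitions. [cite: Coons2011, Theorem 1.5]
-/

-- the directory `ValiantsHypothesis/ValiantsHypothesis` repeats the summit name (tree layout)
set_option linter.dupNamespace false

namespace Summit.ValiantsHypothesis.ValiantsHypothesis.Theorems.LiouvilleSarnakLiouvilleCutRank.StrayRows

open Finset ArithmeticFunction

open Summit.ValiantsHypothesis.ValiantsHypothesis.Theses.LiouvilleSarnak (AlignedCutRank)
open Summit.ValiantsHypothesis.ValiantsHypothesis.Theorems.LiouvilleSarnakAligned
  (alignedCutRank_proof card_image_row_le_two_pow_rank liouville_two_pow_mul)
open Summit.ValiantsHypothesis.ValiantsHypothesis.Theorems.LiouvilleSarnak.AlignedTypeI.CharactersModTwoN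
  (ofBits_injective_boolVec)
open Summit.ValiantsHypothesis.ValiantsHypothesis.Theorems.LiouvilleSarnakLiouvilleCutRank.OneBlock
  (rank_le_card_image_row)

/-! ### §1 The main theorem -/

/-- ★ **Cuts aligned up to `k` stray rows have large rank.**  For all `W, k` there is `n₀` such that for
every `n₁ ≥ n₀` and every balanced cut `π₁` of the `2n₁` bit positions whose positions `≥ n₁ + k` are
all row bits, the Liouville cut matrix `M_{π₁}` has rank `≥ W`. [cite: Coons2011, Theorem 1.5] -/
theorem le_rank_of_topRows (W k : ℕ) : ∃ n₀ : ℕ, ∀ n₁ : ℕ, n₀ ≤ n₁ →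
    ∀ π₁ : Fin n₁ ⊕ Fin n₁ ≃ Fin (2 * n₁),
      (∀ j : Fin (2 * n₁), n₁ + k ≤ (j : ℕ) → (π₁.symm j).isLeft = true) →
      W ≤ (Matrix.of fun r c : Fin n₁ → Bool =>
        (((liouville (Nat.ofBits (fun j : Fin (2 * n₁) => Sum.elim r c (π₁.symm j)) + 1) : ℤ) :
          ℂ))).rank := by
  classical
  -- the aligned rung at rank `2^(k+W)`
  obtain ⟨T₀, hT₀⟩ := alignedCutRank_proof (2 ^ (k + W))
  refine ⟨T₀ + k, fun n₁ hn₁ π₁ htop => ?_⟩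
  set T : ℕ := n₁ - k with hT
  set m : ℕ := n₁ + k with hm
  have hTk : T + k = n₁ := by omega
  have hmT : m + T = 2 * n₁ := by omega
  have hm2k : m = T + 2 * k := by omega
  have hT₀T : T₀ ≤ T := by omega
  set M : Matrix (Fin n₁ → Bool) (Fin n₁ → Bool) ℂ := Matrix.of fun r c : Fin n₁ → Bool =>
      (((liouville (Nat.ofBits (fun j : Fin (2 * n₁) => Sum.elim r c (π₁.symm j)) + 1) : ℤ) : ℂ))
    with hM
  set N : (Fin n₁ → Bool) → (Fin n₁ → Bool) → ℕ := fun r c =>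
    Nat.ofBits (fun j : Fin (2 * n₁) => Sum.elim r c (π₁.symm j)) with hN
  -- the row index sitting at a top position
  have htop' : ∀ j : Fin T, ∃ i : Fin n₁, π₁.symm ⟨m + j, by omega⟩ = Sum.inl i := fun j =>
    Sum.isLeft_iff.mp (htop ⟨m + j, by omega⟩ (by simp [hm]))
  choose τ hτ using htop'
  have hπτ : ∀ j : Fin T, π₁ (Sum.inl (τ j)) = ⟨m + j, by omega⟩ := fun j => by
    rw [← hτ j, Equiv.apply_symm_apply]
  have hτ_of_top : ∀ (i : Fin n₁) (h : ¬ (π₁ (Sum.inl i) : ℕ) < m),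
      τ ⟨(π₁ (Sum.inl i) : ℕ) - m, by have := (π₁ (Sum.inl i)).isLt; omega⟩ = i := by
    intro i h
    have h1 := hπτ ⟨(π₁ (Sum.inl i) : ℕ) - m, by have := (π₁ (Sum.inl i)).isLt; omega⟩
    have h2 : (⟨m + ((π₁ (Sum.inl i) : ℕ) - m), by have := (π₁ (Sum.inl i)).isLt; omega⟩ :
        Fin (2 * n₁)) = π₁ (Sum.inl i) := Fin.ext (by simp; omega)
    rw [h2] at h1
    exact Sum.inl_injective (π₁.injective h1)
  -- rows ≃ stray part × top digits
  let U := {i : Fin n₁ // (π₁ (Sum.inl i) : ℕ) < m}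
  let glue : (U → Bool) → (Fin T → Bool) → (Fin n₁ → Bool) := fun u t i =>
    if h : (π₁ (Sum.inl i) : ℕ) < m then u ⟨i, h⟩
    else t ⟨(π₁ (Sum.inl i) : ℕ) - m, by have := (π₁ (Sum.inl i)).isLt; omega⟩
  -- bits of the glued number
  have hbit_top : ∀ (u : U → Bool) (t : Fin T → Bool) (c : Fin n₁ → Bool) (j : ℕ) (hj : j < T),
      (N (glue u t) c).testBit (m + j) = t ⟨j, hj⟩ := by
    intro u t c j hj
    rw [hN]
    simp only
    rw [Nat.testBit_ofBits_lt _ _ (by omega), hτ ⟨j, hj⟩, Sum.elim_inl]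
    simp only [glue]
    have h : ¬ (π₁ (Sum.inl (τ ⟨j, hj⟩)) : ℕ) < m := by rw [hπτ]; simp
    rw [dif_neg h]
    congr 1
    exact Fin.ext (by simp [hπτ])
  have hbit_low : ∀ (u : U → Bool) (t t' : Fin T → Bool) (c : Fin n₁ → Bool) (j : ℕ), j < m →
      (N (glue u t) c).testBit j = (N (glue u t') c).testBit j := by
    intro u t t' c j hj
    rw [hN]
    simp only
    rw [Nat.testBit_ofBits_lt _ _ (by omega), Nat.testBit_ofBits_lt _ _ (by omega)]
    rcases hq : π₁.symm ⟨j, by omega⟩ with i | i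
    · simp only [Sum.elim_inl, glue]
      have hi : (π₁ (Sum.inl i) : ℕ) < m := by
        have : π₁ (Sum.inl i) = ⟨j, by omega⟩ := by rw [← hq, Equiv.apply_symm_apply]
        rw [this]; exact hj
      rw [dif_pos hi, dif_pos hi]
    · simp only [Sum.elim_inr]
  -- `N (glue u t) c = 2^m * ofBits t + G u c` with `G u c < 2^m`
  set G : (U → Bool) → (Fin n₁ → Bool) → ℕ := fun u c => N (glue u (fun _ => false)) c % 2 ^ m
    with hG
  have hGlt : ∀ u c, G u c < 2 ^ m := fun u c => Nat.mod_lt _ (Nat.two_pow_pos m)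
  have hdecomp : ∀ (u : U → Bool) (t : Fin T → Bool) (c : Fin n₁ → Bool),
      N (glue u t) c = 2 ^ m * Nat.ofBits t + G u c := by
    intro u t c
    apply Nat.eq_of_testBit_eq
    intro j
    rw [Nat.testBit_two_pow_mul_add _ (hGlt u c)]
    by_cases hj : j < m
    · rw [if_pos hj, hG]
      simp only
      rw [Nat.testBit_mod_two_pow]
      simp only [hj, decide_true, Bool.true_and]
      exact hbit_low u t (fun _ => false) c j hj
    · rw [if_neg hj]
      by_cases hjT : j - m < T
      · rw [Nat.testBit_ofBits_lt _ _ hjT]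
        have h1 := hbit_top u t c (j - m) hjT
        rw [show m + (j - m) = j by omega] at h1
        exact h1
      · rw [Nat.testBit_ofBits_ge _ _ (not_lt.mp hjT), hN]
        simp only
        rw [Nat.testBit_ofBits_ge _ _ (by omega)]
  -- every `ρ < 2^m` is some `G u c`
  have hGsurj : ∀ ρ : ℕ, ρ < 2 ^ m → ∃ u c, G u c = ρ := by
    intro ρ hρ
    refine ⟨fun i => ρ.testBit (π₁ (Sum.inl i.1)), fun i => ρ.testBit (π₁ (Sum.inr i)), ?_⟩
    apply Nat.eq_of_testBit_eq
    intro j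
    rw [hG]
    simp only
    rw [Nat.testBit_mod_two_pow]
    by_cases hj : j < m
    · simp only [hj, decide_true, Bool.true_and]
      rw [hN]
      simp only
      rw [Nat.testBit_ofBits_lt _ _ (by omega)]
      rcases hq : π₁.symm ⟨j, by omega⟩ with i | i
      · have hi' : π₁ (Sum.inl i) = ⟨j, by omega⟩ := by rw [← hq, Equiv.apply_symm_apply]
        have hi : (π₁ (Sum.inl i) : ℕ) < m := by rw [hi']; exact hj
        simp only [Sum.elim_inl, glue, dif_pos hi]
        simp [hi']
      · have hi' : π₁ (Sum.inr i) = ⟨j, by omega⟩ := by rw [← hq, Equiv.apply_symm_apply]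
        simp only [Sum.elim_inr, hi']
    · simp only [hj, decide_false, Bool.false_and]
      exact (Nat.testBit_lt_two_pow (lt_of_lt_of_le hρ (Nat.pow_le_pow_right Nat.two_pos
        (not_lt.mp hj)))).symm
  -- the column vectors of the stray-pattern submatrices
  set col : (U → Bool) → (Fin n₁ → Bool) → (Fin T → Bool) → ℂ := fun u c t => M (glue u t) c
    with hcol
  have hcol_eq : ∀ u c t, col u c t = (((liouville (2 ^ m * Nat.ofBits t + G u c + 1)) : ℤ) : ℂ) := by
    intro u c t
    rw [hcol]
    simp only [hM, Matrix.of_apply]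
    rw [show Nat.ofBits (fun j : Fin (2 * n₁) => Sum.elim (glue u t) c (π₁.symm j)) = N (glue u t) c
      from rfl, hdecomp]
  -- rows of the aligned level-`T` matrix appear among the columns
  set A : Matrix (Fin (2 ^ T)) (Fin (2 ^ T)) ℂ := Matrix.of fun a b : Fin (2 ^ T) =>
      (((liouville ((a : ℕ) + 2 ^ T * (b : ℕ) + 1) : ℤ) : ℂ)) with hA
  have hArank : 2 ^ (k + W) ≤ A.rank := hT₀ T hT₀T
  -- for each row `a` of `A`, a pair `(u, c)` with `G u c = 4^k (a+1) - 1`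
  have hρa : ∀ a : Fin (2 ^ T), 2 ^ (2 * k) * ((a : ℕ) + 1) - 1 < 2 ^ m := by
    intro a
    have h1 : 2 ^ (2 * k) * ((a : ℕ) + 1) ≤ 2 ^ (2 * k) * 2 ^ T :=
      Nat.mul_le_mul_left _ (by have := a.isLt; omega)
    have h2 : 2 ^ (2 * k) * 2 ^ T = 2 ^ m := by rw [← pow_add, hm2k, Nat.add_comm]
    have h3 : 0 < 2 ^ (2 * k) * ((a : ℕ) + 1) := Nat.mul_pos (Nat.two_pow_pos _) (Nat.succ_pos _)
    omega
  choose ua ca huca using fun a : Fin (2 ^ T) => hGsurj _ (hρa a)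
  -- the column at `(ua a, ca a)` is row `a` of `A`, re-indexed by `ofBits`
  have hcol_row : ∀ (a : Fin (2 ^ T)) (t : Fin T → Bool),
      col (ua a) (ca a) t = A a ⟨Nat.ofBits t, Nat.ofBits_lt_two_pow t⟩ := by
    intro a t
    rw [hcol_eq, huca a, hA, Matrix.of_apply]
    have h3 : 0 < 2 ^ (2 * k) * ((a : ℕ) + 1) := Nat.mul_pos (Nat.two_pow_pos _) (Nat.succ_pos _)
    have harg : 2 ^ m * Nat.ofBits t + (2 ^ (2 * k) * ((a : ℕ) + 1) - 1) + 1 =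
        2 ^ (2 * k) * ((a : ℕ) + 2 ^ T * Nat.ofBits t + 1) := by
      have h2 : 2 ^ m = 2 ^ (2 * k) * 2 ^ T := by rw [← pow_add, hm2k, Nat.add_comm]
      rw [h2]
      have : 2 ^ (2 * k) * 2 ^ T * Nat.ofBits t + (2 ^ (2 * k) * ((a : ℕ) + 1) - 1) + 1 =
          2 ^ (2 * k) * 2 ^ T * Nat.ofBits t + 2 ^ (2 * k) * ((a : ℕ) + 1) := by omega
      rw [this]
      ring
    rw [harg, liouville_two_pow_mul]
    push_cast
    rw [show ((-1 : ℂ)) ^ (2 * k) = 1 by rw [pow_mul]; norm_num, one_mul]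
  -- hence at least `2^(k+W)` distinct columns over all `(u, c)`
  set Cols : Finset ((Fin T → Bool) → ℂ) :=
    (Finset.univ : Finset ((U → Bool) × (Fin n₁ → Bool))).image (fun p => col p.1 p.2) with hCols
  have hCols_card : 2 ^ (k + W) ≤ Cols.card := by
    -- the re-indexing map `f ↦ f ∘ ofBits` is injective
    let Ψ : (Fin (2 ^ T) → ℂ) → ((Fin T → Bool) → ℂ) :=
      fun f t => f ⟨Nat.ofBits t, Nat.ofBits_lt_two_pow t⟩
    have hΨ : Function.Injective Ψ := by
      intro f g hfg
      funext b
      obtain ⟨t, ht⟩ : ∃ t : Fin T → Bool, (⟨Nat.ofBits t, Nat.ofBits_lt_two_pow t⟩ : Fin (2 ^ T)) = b := by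
        refine ⟨fun i => (b : ℕ).testBit i, Fin.ext ?_⟩
        simp only
        rw [Nat.ofBits_testBit, Nat.mod_eq_of_lt b.isLt]
      have := congrFun hfg t
      simp only [Ψ, ht] at this
      exact this
    have hsub : (Finset.univ.image fun a : Fin (2 ^ T) => A a).image Ψ ⊆ Cols := by
      intro v hv
      obtain ⟨w, hw, rfl⟩ := Finset.mem_image.mp hv
      obtain ⟨a, -, rfl⟩ := Finset.mem_image.mp hw
      rw [hCols, Finset.mem_image]
      refine ⟨(ua a, ca a), Finset.mem_univ _, ?_⟩
      funext t
      exact hcol_row a t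
    calc 2 ^ (k + W) ≤ A.rank := hArank
      _ ≤ (Finset.univ.image fun a : Fin (2 ^ T) => A a).card := rank_le_card_image_row A
      _ = ((Finset.univ.image fun a : Fin (2 ^ T) => A a).image Ψ).card :=
          (Finset.card_image_of_injective _ hΨ).symm
      _ ≤ Cols.card := Finset.card_le_card hsub
  -- pigeonhole over the `2^k` stray patterns
  have hk_card : Fintype.card (U → Bool) ≤ 2 ^ k := by
    rw [Fintype.card_fun, Fintype.card_bool]
    apply Nat.pow_le_pow_right Nat.two_pos
    -- `U` = row indices at low positions: there are `n₁ - T = k` of them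
    have hUc : Fintype.card U + Fintype.card {i : Fin n₁ // ¬ (π₁ (Sum.inl i) : ℕ) < m} = n₁ := by
      rw [Fintype.card_subtype_compl, Nat.add_sub_cancel' (Fintype.card_subtype_le _),
        Fintype.card_fin]
    have hTop : T ≤ Fintype.card {i : Fin n₁ // ¬ (π₁ (Sum.inl i) : ℕ) < m} := by
      have hinj : Function.Injective (fun j : Fin T => (⟨τ j, by rw [hπτ]; simp⟩ :
          {i : Fin n₁ // ¬ (π₁ (Sum.inl i) : ℕ) < m})) := by
        intro j j' h
        have h1 : τ j = τ j' := congrArg Subtype.val h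
        have h2 := hπτ j
        rw [h1, hπτ j'] at h2
        exact Fin.ext (by have := congrArg Fin.val h2; simp at this; omega)
      have := Fintype.card_le_of_injective _ hinj
      simpa using this
    omega
  have hexists : ∃ u : U → Bool, 2 ^ W ≤ (Finset.univ.image (col u)).card := by
    by_contra hno
    push Not at hno
    have hsub : Cols ⊆ Finset.univ.biUnion (fun u : U → Bool => Finset.univ.image (col u)) := by
      intro v hv
      rw [hCols, Finset.mem_image] at hv
      obtain ⟨p, -, rfl⟩ := hv
      exact Finset.mem_biUnion.mpr ⟨p.1, Finset.mem_univ _, Finset.mem_image_of_mem _ (Finset.mem_univ _)⟩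
    have h1 : Cols.card ≤ ∑ u : U → Bool, (Finset.univ.image (col u)).card :=
      (Finset.card_le_card hsub).trans Finset.card_biUnion_le
    have h2 : ∑ u : U → Bool, (Finset.univ.image (col u)).card ≤ ∑ _u : U → Bool, (2 ^ W - 1) :=
      Finset.sum_le_sum fun u _ => by have := hno u; omega
    rw [Finset.sum_const, Finset.card_univ, smul_eq_mul] at h2
    have h3 : Fintype.card (U → Bool) * (2 ^ W - 1) ≤ 2 ^ k * (2 ^ W - 1) :=
      Nat.mul_le_mul_right _ hk_card
    have h4 : 2 ^ k * (2 ^ W - 1) < 2 ^ (k + W) := by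
      rw [pow_add, Nat.mul_sub, mul_one]
      exact Nat.sub_lt (Nat.mul_pos (Nat.two_pow_pos k) (Nat.two_pow_pos W)) (Nat.two_pow_pos k)
    omega
  obtain ⟨u, hu⟩ := hexists
  -- the `u`-submatrix has `≥ 2^W` distinct columns, hence rank `≥ W`
  set S : Matrix (Fin T → Bool) (Fin n₁ → Bool) ℂ := M.submatrix (fun t => glue u t) id with hS
  have hST : ∀ i j, S.transpose i j = 1 ∨ S.transpose i j = -1 := by
    intro c t
    simp only [Matrix.transpose_apply, hS, Matrix.submatrix_apply, id, hM, Matrix.of_apply]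
    rw [liouville_apply (Nat.succ_ne_zero _)]
    rcases neg_one_pow_eq_or ℤ (cardFactors
      (Nat.ofBits (fun j : Fin (2 * n₁) => Sum.elim (glue u t) c (π₁.symm j)) + 1)) with h | h
    · left; rw [h]; norm_num
    · right; rw [h]; norm_num
  have hcols_S : (Finset.univ.image fun c : Fin n₁ → Bool => S.transpose c) =
      Finset.univ.image (col u) := by
    congr 1
  have h2W : 2 ^ W ≤ 2 ^ S.transpose.rank := by
    calc 2 ^ W ≤ (Finset.univ.image (col u)).card := hu
      _ = (Finset.univ.image fun c : Fin n₁ → Bool => S.transpose c).card := by rw [hcols_S]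
      _ ≤ 2 ^ S.transpose.rank := card_image_row_le_two_pow_rank _ hST
  calc W ≤ S.transpose.rank := (Nat.pow_le_pow_iff_right Nat.one_lt_two).mp h2W
    _ = S.rank := Matrix.rank_transpose S
    _ ≤ M.rank := Matrix.rank_submatrix_le M _ _

end Summit.ValiantsHypothesis.ValiantsHypothesis.Theorems.LiouvilleSarnakLiouvilleCutRank.StrayRows
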